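import Literature.Analysis.Fourier.InversionCompactQuotient
import Literature.NumberTheory.Automorphic.AdelicPoissonSummation
import HarnessLib

/-!
# Pointwise Fourier inversion on `𝔸_K^ι ⧸ K^ι` through Tate's box
(Tate, in Cassels–Fröhlich (1967), Ch. XV, Lemma 4.2.2; Cogdell (2004), §1.1, proof of Thm. 1.1:
"*expand `φ` in a Fourier series along `Y_n(k) \ Y_n(𝔸) ≅ (k\𝔸)^{n-1}`*")

Topic `NumberTheory/Automorphic`; namespace `Literature.NumberTheory.Automorphic`. Sequel to
`AdeleQuotientParseval` (Parseval on `𝔸_K^ι ⧸ K^ι` through the product fundamental domain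
`D^ι = piFundamentalDomain K ι`, for the characters `ψ_ξ(v) = ψ_K(∑ ξ_i v_i)`, `ξ ∈ K^ι`, of
`AdelicPoissonSummation`) and the one-variable pointwise inversion `AdeleQuotientFourierInversion`.
Specialising the abstract inversion theorem `Literature.Analysis.Fourier.InversionCompactQuotient`
we PROVE the `ι`-variable **pointwise inversion for continuous `K^ι`-periodic functions with
absolutely summable box coefficients** — the input of each stage of the (pointwise, absolutely
convergent) Fourier–Whittaker expansion of a cusp form on `GL_n` along the column groups
(Cogdell (2004), Thm. 1.1):

* `AdeleRing.hasSum_inv_smul_setIntegral_piFundamentalDomain_mul` — for `ι` finite, any additive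
  Haar measure `ν` on `𝔸_K^ι` and `F : 𝔸_K^ι → ℂ` continuous and `K^ι`-periodic with
  `∑_{ξ ∈ K^ι} |∫_{D^ι} conj ψ(∑ ξ_i v_i) F(v) dν| < ∞`:
  `F(w) = ∑_ξ (ν(D^ι)⁻¹ ∫_{D^ι} conj ψ(∑ ξ_i v_i) F(v) dν(v)) ψ(∑ ξ_i w_i)` for every `w`;
* `AdeleRing.hasSum_inv_smul_setIntegral_piFundamentalDomain` — at `w = 0`:
  `F(0) = ∑_ξ ν(D^ι)⁻¹ ∫_{D^ι} conj ψ(∑ ξ_i v_i) F(v) dν(v)` (and the `tsum` form); the primed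
  version takes the summability of the *normalised* coefficients `ν(D^ι)⁻¹ ∫_{D^ι} conj ψ_ξ F dν`
  (the idiom of the column coefficients `colCoeff` of `MirabolicFourierStage`), which is equivalent
  (`AdeleRing.summable_norm_inv_smul_iff_piFundamentalDomain`, `0 < ν(D^ι) < ∞`).

## References

* J. Tate, in J. W. S. Cassels, A. Fröhlich (eds.), *Algebraic Number Theory* (1967), Ch. XV,
  Lemmas 4.2.1–4.2.2 (PDF p. 360 of the held copy) [CasselsFrohlichANT1967].
* J. W. Cogdell, *Analytic theory of L-functions for GL_n*, in *An Introduction to the Langlands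
  Program* (2004), §1.1, proof of Thm. 1.1 [CogdellAnalyticTheory2004].
-/

noncomputable section

open scoped ComplexConjugate ENNReal
open NumberField IsDedekindDomain MeasureTheory Function

namespace Literature.NumberTheory.Automorphic

section Pi

variable (K : Type) [Field K] [NumberField K] (ι : Type) [Fintype ι]

/-- **Pointwise Fourier inversion on `𝔸_K^ι ⧸ K^ι` through the product fundamental domain.** For
`ι` finite, an additive Haar measure `ν` on `𝔸_K^ι`, and `F : 𝔸_K^ι → ℂ` continuous,
`K^ι`-periodic, with `∑_{ξ ∈ K^ι} |∫_{D^ι} conj ψ(∑_i ξ_i v_i) F(v) dν| < ∞`, one has for every `w`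
`F(w) = ∑_{ξ ∈ K^ι} (ν(D^ι)⁻¹ ∫_{D^ι} conj ψ(∑_i ξ_i v_i) F(v) dν(v)) · ψ(∑_i ξ_i w_i)`
(the characters `ψ_ξ` are injective, `piQuotCharHom_injective`, and separate the points of
`𝔸_K^ι ⧸ K^ι`, `exists_piQuotChar_ne_one`; `Literature.Analysis.Fourier.hasSum_inv_smul_setIntegral_mul_of_periodic`).
[cite: CasselsFrohlichANT1967, Ch. XV Lemma 4.2.2] -/
theorem AdeleRing.hasSum_inv_smul_setIntegral_piFundamentalDomain_mul
    [MeasurableSpace (AdeleRing (𝓞 K) K)] [BorelSpace (AdeleRing (𝓞 K) K)]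
    (ν : Measure (ι → AdeleRing (𝓞 K) K)) [ν.IsAddHaarMeasure]
    {F : (ι → AdeleRing (𝓞 K) K) → ℂ} (hFc : Continuous F)
    (hF : ∀ (v : ι → AdeleRing (𝓞 K) K) (ξ : ι → K),
      F (v + fun i => algebraMap K (AdeleRing (𝓞 K) K) (ξ i)) = F v)
    (hsum : Summable fun ξ : ι → K => ‖∫ v in piFundamentalDomain K ι,
        conj (adeleAddChar K (∑ i, algebraMap K (AdeleRing (𝓞 K) K) (ξ i) * v i) : ℂ) * F v ∂ν‖)
    (w : ι → AdeleRing (𝓞 K) K) :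
    HasSum (fun ξ : ι → K => ((((ν (piFundamentalDomain K ι)).toReal⁻¹ : ℝ) •
        ∫ v in piFundamentalDomain K ι,
          conj (adeleAddChar K (∑ i, algebraMap K (AdeleRing (𝓞 K) K) (ξ i) * v i) : ℂ) * F v ∂ν) *
        (adeleAddChar K (∑ i, algebraMap K (AdeleRing (𝓞 K) K) (ξ i) * w i) : ℂ)))
      (F w) := by
  haveI := locallyCompactSpace_adeleRing' K
  haveI := secondCountableTopology_adeleRing K
  haveI := t2Space_adeleRing K
  haveI : Countable K := NumberField.countable' (K := K)
  haveI : BorelSpace (ι → AdeleRing (𝓞 K) K) := Pi.borelSpace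
  have hfin : ν (piFundamentalDomain K ι) ≠ ⊤ :=
    ((measure_mono subset_closure).trans_lt
      (isCompact_closure_piFundamentalDomain K ι).measure_lt_top).ne
  have hF' : ∀ (v : ι → AdeleRing (𝓞 K) K) (γ : piPrincipalSubgroup K ι), F (v + γ) = F v := by
    intro v γ
    obtain ⟨ξ, hξ⟩ := (piPrincipalSubgroupEquiv K ι).surjective γ
    have : (γ : ι → AdeleRing (𝓞 K) K) = fun i => algebraMap K (AdeleRing (𝓞 K) K) (ξ i) := by
      rw [← hξ, coe_piPrincipalSubgroupEquiv]
    rw [this]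
    exact hF v ξ
  have hsum' : Summable fun ξ : ι → K => ‖∫ v in piFundamentalDomain K ι,
      conj (piQuotCharHom K ι ξ (QuotientAddGroup.mk v) : ℂ) * F v ∂ν‖ := by
    simpa only [piQuotCharHom_apply, piQuotChar_mk, piPairing_apply] using hsum
  have h := Literature.Analysis.Fourier.hasSum_inv_smul_setIntegral_mul_of_periodic ν
    (piQuotCharHom K ι) (isClosed_piPrincipalSubgroup K ι)
    (isAddFundamentalDomain_op_piFundamentalDomain K ι ν) hfin (piQuotCharHom_injective K ι)
    (continuous_piQuotChar K) (fun _ hu => exists_piQuotChar_ne_one K ι hu) hFc hF' hsum' w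
  simpa only [piQuotCharHom_apply, piQuotChar_mk, piPairing_apply] using h

/-- **Inversion at the origin on `𝔸_K^ι ⧸ K^ι`**: for `F` continuous, `K^ι`-periodic with absolutely
summable box coefficients, `F(0) = ∑_{ξ ∈ K^ι} ν(D^ι)⁻¹ ∫_{D^ι} conj ψ(∑_i ξ_i v_i) F(v) dν(v)`.
[cite: CasselsFrohlichANT1967, Ch. XV Lemma 4.2.2] -/
theorem AdeleRing.hasSum_inv_smul_setIntegral_piFundamentalDomain
    [MeasurableSpace (AdeleRing (𝓞 K) K)] [BorelSpace (AdeleRing (𝓞 K) K)]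
    (ν : Measure (ι → AdeleRing (𝓞 K) K)) [ν.IsAddHaarMeasure]
    {F : (ι → AdeleRing (𝓞 K) K) → ℂ} (hFc : Continuous F)
    (hF : ∀ (v : ι → AdeleRing (𝓞 K) K) (ξ : ι → K),
      F (v + fun i => algebraMap K (AdeleRing (𝓞 K) K) (ξ i)) = F v)
    (hsum : Summable fun ξ : ι → K => ‖∫ v in piFundamentalDomain K ι,
        conj (adeleAddChar K (∑ i, algebraMap K (AdeleRing (𝓞 K) K) (ξ i) * v i) : ℂ) * F v ∂ν‖) :
    HasSum (fun ξ : ι → K => (((ν (piFundamentalDomain K ι)).toReal⁻¹ : ℝ) •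
        ∫ v in piFundamentalDomain K ι,
          conj (adeleAddChar K (∑ i, algebraMap K (AdeleRing (𝓞 K) K) (ξ i) * v i) : ℂ) * F v ∂ν))
      (F 0) := by
  have h := AdeleRing.hasSum_inv_smul_setIntegral_piFundamentalDomain_mul K ι ν hFc hF hsum 0
  simpa only [Pi.zero_apply, mul_zero, Finset.sum_const_zero, AddChar.map_zero_eq_one, Circle.coe_one,
    mul_one] using h

/-- `tsum` form: `F(0) = ∑_ξ ν(D^ι)⁻¹ ∫_{D^ι} conj ψ_ξ F dν`.
[cite: CasselsFrohlichANT1967, Ch. XV Lemma 4.2.2] -/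
theorem AdeleRing.apply_zero_eq_tsum_inv_smul_setIntegral_piFundamentalDomain
    [MeasurableSpace (AdeleRing (𝓞 K) K)] [BorelSpace (AdeleRing (𝓞 K) K)]
    (ν : Measure (ι → AdeleRing (𝓞 K) K)) [ν.IsAddHaarMeasure]
    {F : (ι → AdeleRing (𝓞 K) K) → ℂ} (hFc : Continuous F)
    (hF : ∀ (v : ι → AdeleRing (𝓞 K) K) (ξ : ι → K),
      F (v + fun i => algebraMap K (AdeleRing (𝓞 K) K) (ξ i)) = F v)
    (hsum : Summable fun ξ : ι → K => ‖∫ v in piFundamentalDomain K ι,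
        conj (adeleAddChar K (∑ i, algebraMap K (AdeleRing (𝓞 K) K) (ξ i) * v i) : ℂ) * F v ∂ν‖) :
    F 0 = ∑' ξ : ι → K, (((ν (piFundamentalDomain K ι)).toReal⁻¹ : ℝ) •
        ∫ v in piFundamentalDomain K ι,
          conj (adeleAddChar K (∑ i, algebraMap K (AdeleRing (𝓞 K) K) (ξ i) * v i) : ℂ) * F v ∂ν) :=
  (AdeleRing.hasSum_inv_smul_setIntegral_piFundamentalDomain K ι ν hFc hF hsum).tsum_eq.symm

/-- **Normalised versus plain box coefficients**: for an additive Haar measure `ν` on `𝔸_K^ι`,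
`0 < ν(D^ι) < ∞`, so a family `λ(D^ι)⁻¹ • I_ξ` is absolutely summable iff `I_ξ` is (the normalised
coefficients are those of the column transforms of the automorphic files). [folklore] -/
theorem AdeleRing.summable_norm_inv_smul_iff_piFundamentalDomain
    [MeasurableSpace (AdeleRing (𝓞 K) K)] [BorelSpace (AdeleRing (𝓞 K) K)]
    (ν : Measure (ι → AdeleRing (𝓞 K) K)) [ν.IsAddHaarMeasure] {α : Type*} (I : α → ℂ) :
    (Summable fun ξ : α => ‖(((ν (piFundamentalDomain K ι)).toReal⁻¹ : ℝ) • I ξ)‖) ↔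
      Summable fun ξ : α => ‖I ξ‖ := by
  haveI := locallyCompactSpace_adeleRing' K
  haveI := secondCountableTopology_adeleRing K
  haveI := t2Space_adeleRing K
  haveI : Countable K := NumberField.countable' (K := K)
  haveI : BorelSpace (ι → AdeleRing (𝓞 K) K) := Pi.borelSpace
  have hfin : ν (piFundamentalDomain K ι) ≠ ⊤ :=
    ((measure_mono subset_closure).trans_lt
      (isCompact_closure_piFundamentalDomain K ι).measure_lt_top).ne
  have hpos : 0 < (ν (piFundamentalDomain K ι)).toReal :=
    ENNReal.toReal_pos (Literature.Analysis.Fourier.measure_fundamentalDomain_ne_zero ν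
      (isAddFundamentalDomain_op_piFundamentalDomain K ι ν)) hfin
  simp_rw [norm_smul, Real.norm_of_nonneg (inv_nonneg.2 hpos.le)]
  exact summable_mul_left_iff (inv_ne_zero hpos.ne')

/-- **Inversion at the origin, normalised coefficients**: for `F` continuous and `K^ι`-periodic whose
normalised box coefficients `c_ξ = ν(D^ι)⁻¹ ∫_{D^ι} conj ψ_ξ F dν` are absolutely summable,
`F(0) = ∑_ξ c_ξ`. [cite: CasselsFrohlichANT1967, Ch. XV Lemma 4.2.2] -/
theorem AdeleRing.hasSum_inv_smul_setIntegral_piFundamentalDomain'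
    [MeasurableSpace (AdeleRing (𝓞 K) K)] [BorelSpace (AdeleRing (𝓞 K) K)]
    (ν : Measure (ι → AdeleRing (𝓞 K) K)) [ν.IsAddHaarMeasure]
    {F : (ι → AdeleRing (𝓞 K) K) → ℂ} (hFc : Continuous F)
    (hF : ∀ (v : ι → AdeleRing (𝓞 K) K) (ξ : ι → K),
      F (v + fun i => algebraMap K (AdeleRing (𝓞 K) K) (ξ i)) = F v)
    (hsum : Summable fun ξ : ι → K => ‖(((ν (piFundamentalDomain K ι)).toReal⁻¹ : ℝ) •
        ∫ v in piFundamentalDomain K ι,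
          conj (adeleAddChar K (∑ i, algebraMap K (AdeleRing (𝓞 K) K) (ξ i) * v i) : ℂ) * F v ∂ν)‖) :
    HasSum (fun ξ : ι → K => (((ν (piFundamentalDomain K ι)).toReal⁻¹ : ℝ) •
        ∫ v in piFundamentalDomain K ι,
          conj (adeleAddChar K (∑ i, algebraMap K (AdeleRing (𝓞 K) K) (ξ i) * v i) : ℂ) * F v ∂ν))
      (F 0) :=
  AdeleRing.hasSum_inv_smul_setIntegral_piFundamentalDomain K ι ν hFc hF
    ((AdeleRing.summable_norm_inv_smul_iff_piFundamentalDomain K ι ν _).1 hsum)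

end Pi

end Literature.NumberTheory.Automorphic
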